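import Summits.Parity.GeneralizedHardyLittlewood.Theorems.BeyondDiagonalBeatsQuarter.OffDiagLayersMollified
import HarnessLib

/-!
# Route `PrimeLevelFamEdge`, crux K_B (stmt-Parity-20343), line `diagonal_kernel_split` rev 4, plan Ω,
# worker key W-b (i) `OffDiagTailsMollified`: the `r`-TAIL of the mollified off-diagonal IN THE CURRENCY OF THE
# HEART — beyond `R = q⁷` Petersson moduli `c = qr` contribute `≤ ε·mainScaleReal Δ′ q`, eventually in `q`

`OffDiagLayersMollified.lean` (Ω-d3 part 3) bounds the mollified `r`-tail by
`K·q̂⁴·q^{−3/2}·M^{13/5}·(R+1)^{−2/5}`, `M = q̂^{Δ′}`. The heart `stub_offDiagBelowSlack_io` is measured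
against `mainScaleReal Δ′ q = 2ζ(2)² q̂/(Δ′² log² q̂)`. This file converts:
* §1 polynomial gains beat the scale: `log² q̂ ≤ 100 q̂^{1/5}` (`Real.log_le_rpow_div`), hence
  `mainScaleReal Δ′ q ≥ (ζ(2)²/200)·q̂^{4/5}` for `q ≥ 40`, `0 < Δ′ ≤ 2` (`mainScaleReal_ge`), and for every
  `K ≥ 0`, `ε > 0`: `K·q̂^{3/5} ≤ ε·mainScaleReal Δ′ q` for all `q ≥ q₀(K,ε)` and all `0 < Δ′ ≤ 2`
  (`exists_qhat_rpow_le_mul_mainScaleReal`);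
* §2 with `q = (2πq̂)²`, `q̂^{Δ′} ≤ q̂²` and `R ≥ q⁷ ≥ q̂¹⁴`: `q̂⁴ q^{−3/2} (q̂^{Δ′})^{13/5} (R+1)^{−2/5} ≤ q̂^{3/5}`,
  so (**`offDiagMollified_rTail_le`**) for every `ε > 0` there is `q₀` such that for all primes `q ≥ q₀`,
  all `0 < Δ′ ≤ 2` and all `R ≥ q⁷`:
  `|re(2q̂(2π/q)·Σ_{l,m ≤ q̂^{Δ′}} c_l c_m·Σ_{k≥0} offDiagLayer q l m (k+R+1))| ≤ ε·mainScaleReal Δ′ q` —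
  the exponent `A₀ = 7` is absolute (W-b (i) of the Ω SUB-LINE SPLIT).
Elementary real analysis over landed identities; no statement about the heart itself. Helper
(`--supports stmt-Parity-20343`); standard axioms.
«The programme SEARCHES and TYPES; no claim about Landau–Siegel zeros, Theorems 1–2 of arXiv:2211.02515 or
a repaired Margin232 until a kernel theorem says so.»
-/

noncomputable section

open Finset Polynomial
open scoped Real

namespace Summit.Parity.GeneralizedHardyLittlewood.Theorems.BeyondDiagonalBeatsQuarter.PeterssonSplit

open Literature.NumberTheory.LFunctions Literature.NumberTheory.LFunctions.KMV2000

variable {q : ℕ}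

/-! ### §1. Polynomial gains beat the scale `mainScaleReal` -/

/-- `q = (2π q̂)²` (`q̂ = √q/2π`). [cite: KowalskiMichelVanderKam2000, §1 p. 1 (definition of q̂)] -/
theorem two_pi_mul_qhat_sq (q : ℕ) : (2 * π * qhat q) ^ 2 = (q : ℝ) := by
  unfold qhat
  rw [mul_div_cancel₀ _ (by positivity : (2 * π : ℝ) ≠ 0), Real.sq_sqrt (Nat.cast_nonneg _)]

/-- `q̂² ≤ q`. [cite: KowalskiMichelVanderKam2000, §1 p. 1 (definition of q̂)] -/
theorem qhat_sq_le (q : ℕ) : qhat q ^ 2 ≤ (q : ℝ) := by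
  rw [← two_pi_mul_qhat_sq q]
  have hQ : 0 ≤ qhat q := by unfold qhat; positivity
  have h1 : qhat q ≤ 2 * π * qhat q := by nlinarith [Real.pi_gt_three]
  exact pow_le_pow_left₀ hQ h1 2

/-- `log² s ≤ 100·s^{1/5}` for `s ≥ 1` (`log s ≤ 10 s^{1/10}`). [folklore] -/
theorem log_sq_le_rpow {s : ℝ} (hs : 1 ≤ s) : Real.log s ^ 2 ≤ 100 * s ^ (1 / 5 : ℝ) := by
  have hs0 : 0 ≤ s := zero_le_one.trans hs
  have hlog0 : 0 ≤ Real.log s := Real.log_nonneg hs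
  have h := Real.log_le_rpow_div hs0 (by norm_num : (0 : ℝ) < 1 / 10)
  have h' : Real.log s ≤ 10 * s ^ (1 / 10 : ℝ) := by
    rw [div_eq_mul_inv] at h
    norm_num at h
    linarith
  have hsq : (s ^ (1 / 10 : ℝ)) ^ 2 = s ^ (1 / 5 : ℝ) := by
    rw [← Real.rpow_natCast, ← Real.rpow_mul hs0]; norm_num
  calc Real.log s ^ 2 ≤ (10 * s ^ (1 / 10 : ℝ)) ^ 2 := pow_le_pow_left₀ hlog0 h' 2
    _ = 100 * s ^ (1 / 5 : ℝ) := by rw [mul_pow, hsq]; norm_num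

/-- **The scale from below**: for `q ≥ 40` and `0 < Δ′ ≤ 2`, `mainScaleReal Δ′ q ≥ (ζ(2)²/200)·q̂^{4/5}`
(`Δ′² ≤ 4`, `log² q̂ ≤ 100 q̂^{1/5}`). [cite: KowalskiMichelVanderKam2000, §6 p. 19 (second-moment display) — derivation] -/
theorem mainScaleReal_ge (hq : 40 ≤ q) {Δ' : ℝ} (hΔ0 : 0 < Δ') (hΔ2 : Δ' ≤ 2) :
    (π ^ 2 / 6) ^ 2 / 200 * qhat q ^ (4 / 5 : ℝ) ≤ mainScaleReal Δ' q := by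
  set s : ℝ := qhat q with hs
  have hs1 : 1 < s := one_lt_qhat hq
  have hs0 : 0 < s := lt_trans one_pos hs1
  have hlog : 0 < Real.log s := Real.log_pos hs1
  have hms : mainScaleReal Δ' q = 2 * (π ^ 2 / 6) ^ 2 * (s / (Δ' ^ 2 * Real.log s ^ 2)) := by
    simp only [mainScaleReal, hs, qhat]
  have hden : Δ' ^ 2 * Real.log s ^ 2 ≤ 400 * s ^ (1 / 5 : ℝ) := by
    have h1 : Δ' ^ 2 ≤ 4 := by nlinarith
    have h2 := log_sq_le_rpow hs1.le
    calc Δ' ^ 2 * Real.log s ^ 2 ≤ 4 * (100 * s ^ (1 / 5 : ℝ)) :=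
          mul_le_mul h1 h2 (by positivity) (by norm_num)
      _ = 400 * s ^ (1 / 5 : ℝ) := by ring
  have hden0 : 0 < Δ' ^ 2 * Real.log s ^ 2 := by positivity
  have hs5 : s ^ (1 / 5 : ℝ) ≠ 0 := (Real.rpow_pos_of_pos hs0 _).ne'
  have h45 : s ^ (4 / 5 : ℝ) = s / s ^ (1 / 5 : ℝ) := by
    rw [eq_div_iff hs5, ← Real.rpow_add hs0]; norm_num
  rw [hms]
  calc (π ^ 2 / 6) ^ 2 / 200 * s ^ (4 / 5 : ℝ)
      = 2 * (π ^ 2 / 6) ^ 2 * (s / (400 * s ^ (1 / 5 : ℝ))) := by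
        rw [h45]
        field_simp
        ring
    _ ≤ 2 * (π ^ 2 / 6) ^ 2 * (s / (Δ' ^ 2 * Real.log s ^ 2)) := by
        gcongr

/-- **Polynomial gains beat the scale**: for `K ≥ 0` and `ε > 0` there is `q₀` with
`K·q̂^{3/5} ≤ ε·mainScaleReal Δ′ q` for all `q ≥ q₀` and all `0 < Δ′ ≤ 2`.
[cite: KowalskiMichelVanderKam2000, §6 p. 19 — derivation] -/
theorem exists_qhat_rpow_le_mul_mainScaleReal {K ε : ℝ} (hK : 0 ≤ K) (hε : 0 < ε) :
    ∃ q₀ : ℕ, ∀ q : ℕ, q₀ ≤ q → ∀ Δ' : ℝ, 0 < Δ' → Δ' ≤ 2 →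
      K * qhat q ^ (3 / 5 : ℝ) ≤ ε * mainScaleReal Δ' q := by
  set c : ℝ := ε * ((π ^ 2 / 6) ^ 2 / 200) with hc
  have hc0 : 0 < c := by positivity
  set T : ℝ := max 1 ((K / c) ^ 5) with hT
  refine ⟨max 40 ⌈(2 * π * T) ^ 2⌉₊, fun q hq Δ' hΔ0 hΔ2 ↦ ?_⟩
  have hq40 : 40 ≤ q := le_of_max_le_left hq
  have hqT : ⌈(2 * π * T) ^ 2⌉₊ ≤ q := le_of_max_le_right hq
  set s : ℝ := qhat q with hs
  have hs1 : 1 < s := one_lt_qhat hq40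
  have hs0 : 0 < s := lt_trans one_pos hs1
  have hT0 : 0 ≤ T := le_trans zero_le_one (le_max_left _ _)
  have hsT : T ≤ s := by
    have hqR : (2 * π * T) ^ 2 ≤ (q : ℝ) := (Nat.le_ceil _).trans (by exact_mod_cast hqT)
    have hsq : 2 * π * T ≤ Real.sqrt q := by
      rw [show (2 * π * T : ℝ) = Real.sqrt ((2 * π * T) ^ 2) by rw [Real.sqrt_sq (by positivity)]]
      exact Real.sqrt_le_sqrt hqR
    rw [hs, qhat, le_div_iff₀ (by positivity)]
    linarith
  -- `K ≤ c s^{1/5}`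
  have hKc : K ≤ c * s ^ (1 / 5 : ℝ) := by
    have h1 : (K / c) ^ 5 ≤ s := (le_max_right _ _).trans hsT
    have h2 : K / c ≤ s ^ (1 / 5 : ℝ) := by
      have hKc0 : 0 ≤ K / c := div_nonneg hK hc0.le
      calc K / c = (((K / c) ^ 5) ^ (1 / 5 : ℝ)) := by
            rw [← Real.rpow_natCast, ← Real.rpow_mul hKc0]; norm_num
        _ ≤ s ^ (1 / 5 : ℝ) := Real.rpow_le_rpow (by positivity) h1 (by norm_num)
    rwa [div_le_iff₀ hc0, mul_comm] at h2
  have hms := mainScaleReal_ge hq40 hΔ0 hΔ2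
  calc K * s ^ (3 / 5 : ℝ) ≤ (c * s ^ (1 / 5 : ℝ)) * s ^ (3 / 5 : ℝ) :=
        mul_le_mul_of_nonneg_right hKc (by positivity)
    _ = ε * ((π ^ 2 / 6) ^ 2 / 200 * s ^ (4 / 5 : ℝ)) := by
        rw [hc, mul_assoc, mul_assoc, ← Real.rpow_add hs0]; norm_num
    _ ≤ ε * mainScaleReal Δ' q := mul_le_mul_of_nonneg_left hms hε.le

/-! ### §2. The `r`-tail of the mollified off-diagonal in the currency of the heart -/

/-- The exponent bookkeeping: for `q ≥ 40`, `Δ′ ≤ 2` and `R ≥ q⁷`,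
`q̂⁴·q^{−3/2}·(q̂^{Δ′})^{13/5}·(R+1)^{−2/5} ≤ q̂^{3/5}` (`q^{−3/2} ≤ q̂^{−3}`, `(q̂^{Δ′})^{13/5} ≤ q̂^{26/5}`,
`(R+1)^{−2/5} ≤ q̂^{−28/5}`). [folklore] -/
theorem rTail_exponents_le (hq : 40 ≤ q) {Δ' : ℝ} (hΔ2 : Δ' ≤ 2) {R : ℕ}
    (hR : (q : ℝ) ^ 7 ≤ R) :
    qhat q ^ 4 * (q : ℝ) ^ (-(3 / 2 : ℝ)) * (qhat q ^ Δ') ^ (13 / 5 : ℝ) * (((R + 1 : ℕ) : ℝ)) ^ (-(2 / 5 : ℝ)) ≤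
      qhat q ^ (3 / 5 : ℝ) := by
  set s : ℝ := qhat q with hs
  have hs1 : 1 < s := one_lt_qhat hq
  have hs0 : 0 < s := lt_trans one_pos hs1
  have hsq : s ^ 2 ≤ (q : ℝ) := qhat_sq_le q
  -- the three factors
  have h2 : (q : ℝ) ^ (-(3 / 2 : ℝ)) ≤ s ^ (-(3 : ℝ)) := by
    calc (q : ℝ) ^ (-(3 / 2 : ℝ)) ≤ (s ^ 2) ^ (-(3 / 2 : ℝ)) :=
          Real.rpow_le_rpow_of_nonpos (by positivity) hsq (by norm_num)
      _ = s ^ (-(3 : ℝ)) := by rw [← Real.rpow_natCast, ← Real.rpow_mul hs0.le]; norm_num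
  have h3 : (s ^ Δ') ^ (13 / 5 : ℝ) ≤ s ^ (26 / 5 : ℝ) := by
    rw [← Real.rpow_mul hs0.le]
    exact Real.rpow_le_rpow_of_exponent_le hs1.le (by nlinarith)
  have h4 : (((R + 1 : ℕ) : ℝ)) ^ (-(2 / 5 : ℝ)) ≤ s ^ (-(28 / 5 : ℝ)) := by
    have hR1 : s ^ 14 ≤ ((R + 1 : ℕ) : ℝ) := by
      calc s ^ 14 = (s ^ 2) ^ 7 := by ring
        _ ≤ (q : ℝ) ^ 7 := pow_le_pow_left₀ (by positivity) hsq 7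
        _ ≤ R := hR
        _ ≤ ((R + 1 : ℕ) : ℝ) := by push_cast; linarith
    calc (((R + 1 : ℕ) : ℝ)) ^ (-(2 / 5 : ℝ)) ≤ (s ^ 14) ^ (-(2 / 5 : ℝ)) :=
          Real.rpow_le_rpow_of_nonpos (by positivity) hR1 (by norm_num)
      _ = s ^ (-(28 / 5 : ℝ)) := by rw [← Real.rpow_natCast, ← Real.rpow_mul hs0.le]; norm_num
  calc s ^ 4 * (q : ℝ) ^ (-(3 / 2 : ℝ)) * (s ^ Δ') ^ (13 / 5 : ℝ) * (((R + 1 : ℕ) : ℝ)) ^ (-(2 / 5 : ℝ))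
      ≤ s ^ 4 * s ^ (-(3 : ℝ)) * s ^ (26 / 5 : ℝ) * s ^ (-(28 / 5 : ℝ)) := by gcongr
    _ = s ^ (3 / 5 : ℝ) := by
        rw [← Real.rpow_natCast s 4, ← Real.rpow_add hs0, ← Real.rpow_add hs0, ← Real.rpow_add hs0]
        norm_num

/-- **W-b (i): the `r`-tail of the mollified off-diagonal is `≤ ε·mainScaleReal`, eventually, beyond `R = q⁷`.**
For every `ε > 0` there is `q₀` such that for all primes `q ≥ q₀`, all `0 < Δ′ ≤ 2` and all `R ≥ q⁷`:
`|re(2q̂(2π/q)·Σ_{l,m ≤ q̂^{Δ′}} c_l c_m·Σ_{k≥0} offDiagLayer q l m (k+R+1))| ≤ ε·mainScaleReal Δ′ q`,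
`c_m = mollifierCoeff X² q̂^{Δ′} m` (the second term of `offDiagMollified_eq_head_add_tail`). So in the heart
only the Petersson moduli `c = qr`, `r ≤ q⁷`, matter. [cite: KowalskiMichel2000, §2.4.2 p. 312 (23); KowalskiMichelVanderKam2000, (22) p. 12, §6 p. 19 — derivation] -/
theorem offDiagMollified_rTail_le {ε : ℝ} (hε : 0 < ε) :
    ∃ q₀ : ℕ, ∀ (q : ℕ) [NeZero q], q.Prime → q₀ ≤ q → ∀ Δ' : ℝ, 0 < Δ' → Δ' ≤ 2 → ∀ R : ℕ,
      (q : ℝ) ^ 7 ≤ R →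
        |(2 * (qhat q : ℂ) * (2 * π / q) *
            ∑ l ∈ Icc 1 ⌊qhat q ^ Δ'⌋₊, ∑ m ∈ Icc 1 ⌊qhat q ^ Δ'⌋₊,
              ((mollifierCoeff (X ^ 2) (qhat q ^ Δ') l * mollifierCoeff (X ^ 2) (qhat q ^ Δ') m : ℝ) : ℂ) *
                ∑' k : ℕ, offDiagLayer q l m (k + (R + 1))).re| ≤
          ε * mainScaleReal Δ' q := by
  obtain ⟨K, hK0, hK⟩ := exists_abs_offDiagMollified_tail_le
  obtain ⟨q₁, hq₁⟩ := exists_qhat_rpow_le_mul_mainScaleReal hK0 hε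
  refine ⟨max 40 q₁, fun q _ hq hq0 Δ' hΔ0 hΔ2 R hR ↦ ?_⟩
  have hq40 : 40 ≤ q := le_of_max_le_left hq0
  have hqq₁ : q₁ ≤ q := le_of_max_le_right hq0
  have hs1 : 1 < qhat q := one_lt_qhat hq40
  have hM : 1 < qhat q ^ Δ' := Real.one_lt_rpow hs1 hΔ0
  calc _ ≤ K * qhat q ^ 4 * (q : ℝ) ^ (-(3 / 2 : ℝ)) * (qhat q ^ Δ') ^ (13 / 5 : ℝ) *
          (((R + 1 : ℕ) : ℝ)) ^ (-(2 / 5 : ℝ)) := hK q hq Δ' hM R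
    _ = K * (qhat q ^ 4 * (q : ℝ) ^ (-(3 / 2 : ℝ)) * (qhat q ^ Δ') ^ (13 / 5 : ℝ) *
          (((R + 1 : ℕ) : ℝ)) ^ (-(2 / 5 : ℝ))) := by ring
    _ ≤ K * qhat q ^ (3 / 5 : ℝ) := mul_le_mul_of_nonneg_left (rTail_exponents_le hq40 hΔ2 hR) hK0
    _ ≤ ε * mainScaleReal Δ' q := hq₁ q hqq₁ Δ' hΔ0 hΔ2

/-- **W-b (i), packaged with the split**: for every `ε > 0` there is `q₀` such that for all primes `q ≥ q₀`,
all `0 < Δ′ ≤ 2` and all `R ≥ q⁷`,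
`|offDiagMollified Δ′ q + re(2q̂(2π/q)·Σ_{1≤r≤R} Σ_{l,m} c_l c_m·offDiagLayer q l m r)| ≤ ε·mainScaleReal Δ′ q`
(`offDiagMollified_eq_head_add_tail` and `offDiagMollified_rTail_le`).
[cite: KowalskiMichel2000, §2.4.2 p. 312 (23); KowalskiMichelVanderKam2000, (22) p. 12, §6 p. 19 — derivation] -/
theorem offDiagMollified_add_head_le {ε : ℝ} (hε : 0 < ε) :
    ∃ q₀ : ℕ, ∀ (q : ℕ) [NeZero q], q.Prime → q₀ ≤ q → ∀ Δ' : ℝ, 0 < Δ' → Δ' ≤ 2 → ∀ R : ℕ,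
      (q : ℝ) ^ 7 ≤ R →
        |offDiagMollified Δ' q +
            (2 * (qhat q : ℂ) * (2 * π / q) *
              ∑ r ∈ Icc 1 R, ∑ l ∈ Icc 1 ⌊qhat q ^ Δ'⌋₊, ∑ m ∈ Icc 1 ⌊qhat q ^ Δ'⌋₊,
                ((mollifierCoeff (X ^ 2) (qhat q ^ Δ') l * mollifierCoeff (X ^ 2) (qhat q ^ Δ') m : ℝ) : ℂ) *
                  offDiagLayer q l m r).re| ≤
          ε * mainScaleReal Δ' q := by
  obtain ⟨q₀, hq₀⟩ := offDiagMollified_rTail_le hε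
  refine ⟨q₀, fun q _ hq hq0 Δ' hΔ0 hΔ2 R hR ↦ ?_⟩
  have h := hq₀ q hq hq0 Δ' hΔ0 hΔ2 R hR
  rw [offDiagMollified_eq_head_add_tail hq Δ' R]
  rw [show ∀ a b : ℝ, -a - b + a = -b from fun a b ↦ by ring, abs_neg]
  exact h

end Summit.Parity.GeneralizedHardyLittlewood.Theorems.BeyondDiagonalBeatsQuarter.PeterssonSplit
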